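import Summits.ResolutionOfSingularities.ResolutionOfSingularities.Theses.FrobeniusLadder
import Literature.RingTheory.TightClosure.TightClosure
import Literature.AlgebraicGeometry.Resolution.ResolutionOfCurves
import Summits.ResolutionOfSingularities.ResolutionOfSingularities.Theorems.FrobeniusLadderFRationalModificationFlatDescent
import Summits.ResolutionOfSingularities.ResolutionOfSingularities.Theorems.FrobeniusLadderFRationalModificationSopWeaklyRegular
import Summits.ResolutionOfSingularities.ResolutionOfSingularities.Theorems.FrobeniusLadderFRationalModificationReduction
import Summits.ResolutionOfSingularities.ResolutionOfSingularities.Theorems.FrobeniusLadderFRationalModificationIntegralModel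
import Summits.ResolutionOfSingularities.ResolutionOfSingularities.Theorems.FrobeniusLadderFRationalModificationIntegralForm
import Summits.ResolutionOfSingularities.ResolutionOfSingularities.Theorems.FrobeniusLadderFRationalModificationLocalChart
import Summits.ResolutionOfSingularities.ResolutionOfSingularities.Theorems.FrobeniusLadderFRationalModificationDivisorCertificate
import Summits.ResolutionOfSingularities.ResolutionOfSingularities.Theorems.FRationalModification.Negative.LoadBearing
import Mathlib.AlgebraicGeometry.Morphisms.QuasiFinite
import Mathlib.AlgebraicGeometry.Noetherian
import HarnessLib

/-!
# Crux `FRationalModification` — the finite flat CERTIFIED-COVER form (line `Sketch`, skeleton v7)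

Support lemmas for crux stmt-ResolutionOfSingularities-15316
(`Summit.ResolutionOfSingularities.ResolutionOfSingularities.Theses.FrobeniusLadder.FRationalModification`,
route `FrobeniusLadder`, rung 3: a reduced separated finite-type `X/k`, `char k = p`, with a locally
integral Cohen–Macaulay F-injective proper birational model has an F-rational proper birational model),
filed by the line lead (line `Sketch`, skeleton `Cruxes/FRationalModification/Lines/Sketch.lean` v7,
lead cycle 3). Skeleton v7 proves the crux from ONE open stub `stub_cover`, stated here inline as the
hypothesis of `fRationalModification_of_cover`: every INTEGRAL separated finite-type `Y/k` with
rung-2 stalks has a proper birational `π : Y₂ → Y` and a FINITE FLAT `h : W → Y₂` such that over every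
`x ∈ Y₂` some `w ∈ W` has a stalk which EITHER is rung-3 (domain; ideals generated by systems of
parameters tightly closed, inline) OR is a domain with a DIVISOR CERTIFICATE (`g ∈ 𝔪`, `g ≠ 0`,
`𝒪_{W,w}/(g)` Cohen–Macaulay and F-injective in its own s.o.p. language, `gⁿ` a parameter test
element). This is the interface the construction frames of the crux's idea cards produce (an
F-rational model: `W = Y₂`; the flattened regular alteration: `W` = the flat strict transform; an
exceptional Cartier hull that is CM F-injective: the certificate), and this file certifies what it
is worth:

* §1 `isFRational_of_divisorCertificate`, `rungThree_of_coverPoint` — a certified cover point gives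
  the rung-3 clause DOWNSTAIRS: the stalk map of a flat, locally quasi-finite morphism is a flat
  quasi-finite local homomorphism (Mathlib `Flat.stalkMap`, `Scheme.Hom.quasiFiniteAt`), hence a
  faithfully flat equidimensional chart (`LocalChart.stub_localChart`, p132604); the stalk upstairs is
  F-rational in either branch (`DivisorCertificate.stub_divisorCertificate`, p132840, feeding the
  landed Fedder–Watanabe chain `IntegralModel.isFRational_of_FW`); `FlatDescent.stub_flatDescent`
  descends.
* §2 `fRationalModification_of_cover` — the v7 skeleton's composition with its open stub as a
  hypothesis, sorry-free (`Reduction.stub_reduction` + §1).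
* (companion file `FrobeniusLadderFRationalModificationCoverIff.lean`) the converse — a rung-3 model is
  a certified cover, so the cover form IS the crux — and the summit / dimension-`≤ 1` remarks.

No definition is declared; every statement is written inline in the route file's vocabulary.
-/

-- single-problem summit: the doubled namespace component `ResolutionOfSingularities` is forced
set_option linter.dupNamespace false

noncomputable section

open CategoryTheory AlgebraicGeometry TopologicalSpace IsLocalRing RingTheory.Sequence
open Literature.RingTheory.TightClosure Literature.AlgebraicGeometry.Resolution
open Summit.ResolutionOfSingularities.ResolutionOfSingularities.Theses.FrobeniusLadder
open Summit.ResolutionOfSingularities.ResolutionOfSingularities.Theorems.FRationalModification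

namespace Summit.ResolutionOfSingularities.ResolutionOfSingularities.Theorems.FRationalModification.Cover

/-! ## §1 A certified cover point gives the rung-3 clause downstairs -/

/-- **The divisor-certificate branch makes the stalk F-rational**: on a Noetherian local domain `S`
of characteristic `p`, a divisor certificate (`g ∈ 𝔪`, `g ≠ 0`, `S/(g)` Cohen–Macaulay and
F-injective in its own s.o.p. language) plus the inline parameter-test-element clause for `g` give
`IsFRational S p`: `DivisorCertificate.stub_divisorCertificate` supplies the Cohen–Macaulay property
and the Fedder–Watanabe data upstairs, the inline clause is the `tightClosure` one
(`mem_tightClosure_iff_of_isDomain`), and the landed chain `IntegralModel.isFRational_of_FW`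
(Fedder–Watanabe 2.13, power lift, exchange, adapted generators) concludes.
[cite: FedderWatanabe1989, Prop. 2.13; folklore] -/
theorem isFRational_of_divisorCertificate (p : ℕ) [Fact p.Prime] {S : Type*} [CommRing S]
    [IsLocalRing S] [IsNoetherianRing S] [IsDomain S] [CharP S p] {g : S}
    (hgm : g ∈ maximalIdeal S) (hg0 : g ≠ 0)
    (hD : ∀ d : ℕ, ringKrullDim (S ⧸ Ideal.span {g}) = d → ∀ t : Fin d → S ⧸ Ideal.span {g},
      (Ideal.span (Set.range t)).radical.IsMaximal →
        RingTheory.Sequence.IsWeaklyRegular (S ⧸ Ideal.span {g}) (List.ofFn t) ∧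
        ∀ y : S ⧸ Ideal.span {g}, (∃ e : ℕ, y ^ p ^ e ∈
          Ideal.span ((fun z : S ⧸ Ideal.span {g} => z ^ p ^ e) ''
            (Ideal.span (Set.range t) : Set (S ⧸ Ideal.span {g})))) →
          y ∈ Ideal.span (Set.range t))
    (htest : ∃ n : ℕ, ∀ m : ℕ, ringKrullDim S = m → ∀ s : Fin m → S,
      (Ideal.span (Set.range s)).radical.IsMaximal → ∀ y c : S, c ≠ 0 →
        (∀ e : ℕ, c * y ^ p ^ e ∈
          Ideal.span ((fun z : S => z ^ p ^ e) '' (Ideal.span (Set.range s) : Set S))) →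
        g ^ n * y ∈ Ideal.span (Set.range s)) :
    IsFRational S p := by
  obtain ⟨hCM, d, hd, hFinj⟩ := DivisorCertificate.stub_divisorCertificate p hgm hg0 hD
  refine IntegralModel.isFRational_of_FW p
    (fun n s hs => SopWeaklyRegular.stub_sopWeaklyRegular hCM s hs) hd hgm hg0 hFinj ?_
  obtain ⟨n, hn⟩ := htest
  refine ⟨n, fun m s hs y hy => ?_⟩
  obtain ⟨hdim, hrad⟩ := isSystemOfParameters_iff.mp hs
  obtain ⟨c, hc, hcy⟩ := (mem_tightClosure_iff_of_isDomain p).mp hy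
  exact hn m hdim s hrad y c hc hcy

/-- **A certified cover point gives the rung-3 clause downstairs.** Let `h : W → Y₂` be flat and
locally quasi-finite (e.g. finite), `W`, `Y₂` locally Noetherian, `w ∈ W` with `𝒪_{W,w}` of
characteristic `p` carrying the rung-3 clause or a divisor certificate. Then `𝒪_{Y₂, h w}` satisfies
the rung-3 clause: the stalk map is a flat (`Flat.stalkMap`) quasi-finite (`Scheme.Hom.quasiFiniteAt`)
local homomorphism of Noetherian local rings, hence faithfully flat with `dim 𝒪_{W,w} = dim 𝒪_{Y₂,h w}`
and nilpotent closed fibre (`LocalChart.stub_localChart`, Matsumura 15.1); `𝒪_{W,w}` is F-rational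
in either branch; and F-rationality descends along such a chart (`FlatDescent.stub_flatDescent`,
Hochster–Huneke (4.1)–(4.2)). [cite: HochsterHuneke1994, (4.1)–(4.2); Matsumura1987, Thm. 15.1;
folklore] -/
theorem rungThree_of_coverPoint (p : ℕ) [Fact p.Prime] {W Y₂ : Scheme.{0}} (h : W ⟶ Y₂)
    [LocallyQuasiFinite h] [Flat h] [IsLocallyNoetherian W] [IsLocallyNoetherian Y₂] (w : W)
    [CharP (W.presheaf.stalk w) p]
    (hw : (IsDomain (W.presheaf.stalk w) ∧ ∀ d : ℕ, ringKrullDim (W.presheaf.stalk w) = d →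
          ∀ s : Fin d → W.presheaf.stalk w, (Ideal.span (Set.range s)).radical.IsMaximal →
            ∀ y c : W.presheaf.stalk w, c ≠ 0 →
              (∀ e : ℕ, c * y ^ p ^ e ∈
                Ideal.span ((fun z : W.presheaf.stalk w => z ^ p ^ e) ''
                  (Ideal.span (Set.range s) : Set (W.presheaf.stalk w)))) →
              y ∈ Ideal.span (Set.range s)) ∨
      (IsDomain (W.presheaf.stalk w) ∧ ∃ g : W.presheaf.stalk w,
        g ∈ maximalIdeal (W.presheaf.stalk w) ∧ g ≠ 0 ∧
        (∀ d : ℕ, ringKrullDim (W.presheaf.stalk w ⧸ Ideal.span {g}) = d →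
          ∀ t : Fin d → W.presheaf.stalk w ⧸ Ideal.span {g},
            (Ideal.span (Set.range t)).radical.IsMaximal →
              RingTheory.Sequence.IsWeaklyRegular (W.presheaf.stalk w ⧸ Ideal.span {g})
                (List.ofFn t) ∧
              ∀ y : W.presheaf.stalk w ⧸ Ideal.span {g}, (∃ e : ℕ, y ^ p ^ e ∈
                Ideal.span ((fun z : W.presheaf.stalk w ⧸ Ideal.span {g} => z ^ p ^ e) ''
                  (Ideal.span (Set.range t) : Set (W.presheaf.stalk w ⧸ Ideal.span {g})))) →
                y ∈ Ideal.span (Set.range t)) ∧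
        ∃ n : ℕ, ∀ m : ℕ, ringKrullDim (W.presheaf.stalk w) = m →
          ∀ s : Fin m → W.presheaf.stalk w, (Ideal.span (Set.range s)).radical.IsMaximal →
            ∀ y c : W.presheaf.stalk w, c ≠ 0 →
              (∀ e : ℕ, c * y ^ p ^ e ∈
                Ideal.span ((fun z : W.presheaf.stalk w => z ^ p ^ e) ''
                  (Ideal.span (Set.range s) : Set (W.presheaf.stalk w)))) →
              g ^ n * y ∈ Ideal.span (Set.range s))) :
    IsDomain (Y₂.presheaf.stalk (h.base w)) ∧ ∀ d : ℕ, ringKrullDim (Y₂.presheaf.stalk (h.base w)) = d →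
          ∀ s : Fin d → Y₂.presheaf.stalk (h.base w), (Ideal.span (Set.range s)).radical.IsMaximal →
            ∀ y c : Y₂.presheaf.stalk (h.base w), c ≠ 0 →
              (∀ e : ℕ, c * y ^ p ^ e ∈
                Ideal.span ((fun z : Y₂.presheaf.stalk (h.base w) => z ^ p ^ e) ''
                  (Ideal.span (Set.range s) : Set (Y₂.presheaf.stalk (h.base w))))) →
              y ∈ Ideal.span (Set.range s) := by
  -- the chart `R = 𝒪_{Y₂, h w} → S = 𝒪_{W, w}`
  let R := Y₂.presheaf.stalk (h.base w)
  let S := W.presheaf.stalk w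
  letI : Algebra R S := (h.stalkMap w).hom.toAlgebra
  haveI : Module.Flat R S := Flat.stalkMap h w
  haveI : IsLocalHom (algebraMap R S) := inferInstanceAs (IsLocalHom (h.stalkMap w).hom)
  haveI : Algebra.QuasiFinite R S := h.quasiFiniteAt w
  obtain ⟨hff, hdim, hfib⟩ := LocalChart.stub_localChart (R := R) (S := S)
  -- `S` is a domain and F-rational in either branch
  haveI : IsDomain S := hw.elim And.left And.left
  have hFR : IsFRational S p := by
    rcases hw with ⟨-, h3⟩ | ⟨-, g, hgm, hg0, hD, htest⟩
    · exact (isFRational_iff_of_isDomain p).mpr h3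
    · exact isFRational_of_divisorCertificate p hgm hg0 hD htest
  exact FlatDescent.stub_flatDescent p hdim hfib hFR

/-! ## §2 The crux from the cover form (skeleton v7 with its open stub as hypothesis) -/

/-- **The certified-cover form implies the crux** (skeleton v7, sorry-free with the open stub
`stub_cover` as the hypothesis `hcov`): reduce to integral rung-2 `Y/k` (`Reduction.stub_reduction`:
clopen integral components of the rung-2 model, disjoint union of models, composition of proper
birational maps); on such a `Y` take the modification `Y₂ → Y` and the finite flat chart scheme
`h : W → Y₂` of `hcov`; at `x ∈ Y₂` pick the certified `w` over `x` and descend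
(`rungThree_of_coverPoint`; stalks of `k`-schemes have characteristic `p`, `Negative.charP_stalk`).
[folklore] -/
theorem fRationalModification_of_cover
    (hcov : ∀ (p : ℕ) [Fact p.Prime], ∀ (k : Type) [Field k] [CharP k p] (Y : Scheme.{0}) (g : Y ⟶ Spec (.of k)),
      IsSeparated g → LocallyOfFiniteType g → QuasiCompact g → IsIntegral Y →
      (∀ y : Y, IsDomain (Y.presheaf.stalk y) ∧ ∀ d : ℕ, ringKrullDim (Y.presheaf.stalk y) = d →
      ∀ s : Fin d → Y.presheaf.stalk y, (Ideal.span (Set.range s)).radical.IsMaximal →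
        RingTheory.Sequence.IsWeaklyRegular (Y.presheaf.stalk y) (List.ofFn s) ∧
        ∀ w : Y.presheaf.stalk y, (∃ e : ℕ, w ^ p ^ e ∈
          Ideal.span ((fun z : Y.presheaf.stalk y => z ^ p ^ e) ''
            (Ideal.span (Set.range s) : Set (Y.presheaf.stalk y)))) →
          w ∈ Ideal.span (Set.range s)) →
      ∃ (Y₂ : Scheme.{0}) (π : Y₂ ⟶ Y), IsProper π ∧ IsBirational π ∧
        ∃ (W : Scheme.{0}) (h : W ⟶ Y₂), IsFinite h ∧ Flat h ∧
        ∀ x : Y₂, ∃ w : W, h.base w = x ∧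
          ((IsDomain (W.presheaf.stalk w) ∧
              ∀ d : ℕ, ringKrullDim (W.presheaf.stalk w) = d → ∀ s : Fin d → W.presheaf.stalk w,
                (Ideal.span (Set.range s)).radical.IsMaximal → ∀ y c : W.presheaf.stalk w, c ≠ 0 →
                  (∀ e : ℕ, c * y ^ p ^ e ∈
                    Ideal.span ((fun z : W.presheaf.stalk w => z ^ p ^ e) ''
                      (Ideal.span (Set.range s) : Set (W.presheaf.stalk w)))) →
                  y ∈ Ideal.span (Set.range s)) ∨
            (IsDomain (W.presheaf.stalk w) ∧ ∃ g : W.presheaf.stalk w,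
              g ∈ maximalIdeal (W.presheaf.stalk w) ∧ g ≠ 0 ∧
              (∀ d : ℕ, ringKrullDim (W.presheaf.stalk w ⧸ Ideal.span {g}) = d →
                ∀ t : Fin d → W.presheaf.stalk w ⧸ Ideal.span {g},
                  (Ideal.span (Set.range t)).radical.IsMaximal →
                    RingTheory.Sequence.IsWeaklyRegular (W.presheaf.stalk w ⧸ Ideal.span {g})
                      (List.ofFn t) ∧
                    ∀ y : W.presheaf.stalk w ⧸ Ideal.span {g}, (∃ e : ℕ, y ^ p ^ e ∈
                      Ideal.span ((fun z : W.presheaf.stalk w ⧸ Ideal.span {g} => z ^ p ^ e) ''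
                        (Ideal.span (Set.range t) : Set (W.presheaf.stalk w ⧸ Ideal.span {g})))) →
                      y ∈ Ideal.span (Set.range t)) ∧
              ∃ n : ℕ, ∀ m : ℕ, ringKrullDim (W.presheaf.stalk w) = m →
                ∀ s : Fin m → W.presheaf.stalk w, (Ideal.span (Set.range s)).radical.IsMaximal →
                  ∀ y c : W.presheaf.stalk w, c ≠ 0 →
                    (∀ e : ℕ, c * y ^ p ^ e ∈
                      Ideal.span ((fun z : W.presheaf.stalk w => z ^ p ^ e) ''
                        (Ideal.span (Set.range s) : Set (W.presheaf.stalk w)))) →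
                    g ^ n * y ∈ Ideal.span (Set.range s)))) :
    FRationalModification := by
  intro p hp k _ _ X f hsep hft hqc _ hX₁
  haveI : Fact p.Prime := ⟨hp⟩
  haveI := hsep; haveI := hft; haveI := hqc
  refine Reduction.stub_reduction p k X f (fun Y g hs hl hq hY h₂ => ?_) hX₁
  haveI := hs; haveI := hl; haveI := hq; haveI := hY
  obtain ⟨Y₂, π, hπ, hbir, W, h, hfin, hfl, hw⟩ := hcov p k Y g hs hl hq hY h₂
  haveI := hπ; haveI := hfin; haveI := hfl
  haveI : IsLocallyNoetherian Y₂ := LocallyOfFiniteType.isLocallyNoetherian (π ≫ g)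
  haveI : IsLocallyNoetherian W := LocallyOfFiniteType.isLocallyNoetherian (h ≫ π ≫ g)
  refine ⟨Y₂, π, hπ, hbir, fun x => ?_⟩
  obtain ⟨w, rfl, hw⟩ := hw x
  haveI : CharP (W.presheaf.stalk w) p := Negative.charP_stalk (h ≫ π ≫ g) w
  exact rungThree_of_coverPoint p h w hw

end Summit.ResolutionOfSingularities.ResolutionOfSingularities.Theorems.FRationalModification.Cover

end
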